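import Literature.MathematicalPhysics.QuantumFieldTheory.Balaban1983to89.B9Local342GOfBlocksXBK
import Literature.MathematicalPhysics.QuantumFieldTheory.Balaban1983to89.B9PinMembersKLevelV1
import Literature.MathematicalPhysics.QuantumFieldTheory.Balaban1983to89.B9RWSumsReadsNbr

/-!
# `Balaban1983to89.B9BlockKeyTransferXBK` — T. Bałaban, *Propagators and renormalization transformations for lattice gauge theories. II*, Commun. Math. Phys. **96**
# (1984) 223–250 [Balaban1984PropagatorsII], (2.45)–(2.46) p. 231 + (2.51)–(2.54) pp. 232–233, with *Propagators for lattice gauge theories in a background field*,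
# CMP **99** (1985) [Balaban1985BackgroundPropagators], (3.41)–(3.42) p. 397 and Thm 3.3 p. 399: THE KEY TRANSFER «BLOCK-KEYED ⟹ INDEX-KEYED» FOR BLOCK MAJORANTS
# ON ANY CARRIER (generic in the two keys and their two laws) AND THE ROWS-19 FACE OF THE pub-ymgap N06 CERTIFICATE — `Local342G` of an INDEX-keyed bond-sector
# record (`blk = blkBK bI`) from BLOCK-keyed (3.42) tables over the all-blocks geometry, for EVERY member (the bond-sector companion of `B9BlockKeyTransferXSK`;
# dag-lead WORDS 317 (2)(i), 2026-08-30)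

statement-level skeleton of published theorems with citation tags; proofs where landed; nothing here is a claim about the Yang–Mills mass gap

**The print.** [4] p. 231: *"d(x, x′) = d(y, y′) if x ∈ B^j(y), x′ ∈ B^{j′}(y′)"* ((2.45)–(2.46): the distance of two points is read on their BLOCKS); (2.51) p. 232:
*"|(Tλ)(x)| ≤ K(y, y′)|λ| for x ∈ B^j(y), supp λ ⊂ B^{j′}(y′)"*; (2.54) p. 233 (the triangle inequality of `d`); p. 248 (*"sites replaced by bonds"*); B9 (3.41)–(3.42) p. 397:
*"x ∈ Δ(y), y ∈ Λ_j … y, y′ ∈ 𝔅"*; Thm 3.3 p. 399 (*«with G′(U) replaced by G(U) and λ replaced by a function J defined at bonds»*).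

**Why this file (pub-ymgap, node N06 [B9], rows 19; LOCATED-28).**  The rows-19 consumers of the N06 certificate read an INDEX-keyed bond-sector record `𝔬A x : Ops310
(geo9Y x) …` (`blk = blkY = blkBK (bI x)`, `D ∕ Dstar ∕ Lap = DcoK ∕ DscoK ∕ LcoK`); the all-members (3.42) supply is BLOCK-keyed (`B9Local342GOfBlocksXBK`: tables over `geoBK`
keyed by the block `y(b₋) = blkV1 b` of the bond's initial point, no bond map, no section).  THIS FILE is the transfer between the two keys, stated ONCE for any carrier — §1 ★★
`hasMajorant_keyTransfer` (any `X`, block key `blkB : X → 𝔅`, index key `blkI : X → ⋃_jΛ_j`, 1-faithfulness `d(β(blkI p), blkB p) ≤ 1`, scale-faithfulness `ℓ(blkI p) =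
ℓ(blkB p)`, count `N₁` of blocks within block-distance `1` ⟹ the index-keyed majorant with constant `N₁·e^{2δ}·C`, SAME rate; `B9BlockKeyTransferXSK.hasMajorant_blkSK_of_blkOfSK`
is the instance `X = XSK`, `blkB = blkOfSK`, `blkI = blkSK (sIK bI)`), ★ `hasMajorantHom_keyTransfer` — and §2 ★★ `local342G_of_blocks_idxPins`, THE ROWS-19 FACE: for ANY
index-keyed bond record `𝔬A : Ops310 (geo9Y x) B (XBK κ x.toKIdx) (XBK κ x.toKIdx) ι A` carrying the certificate's pins (`hblkA hblkYA hDcoA hDscoA hLcoA`) and a cube-letter pin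
`hGsqA : 𝔬A.Gsq U j = GcoK … (O j) U`, the block tables h0–h3 of `B9Local342GOfBlocksXBK` §3 + the two laws of `bI` on bonds + the count give `Local342G 𝔬A R H (N₁·e^{2δ}·(c_R·B_c))
δ U` — rate KEPT, every factor in the constant (the site-side convention of `local342_opsWalkY_of_blocks`).

HONEST SCOPE.  Finite bookkeeping ((2.54) twice + a block count); the block tables and the two laws are HYPOTHESES; nothing of [B9] Cor. 3.6 ∕ Thm 3.3 asserted; count-neutral;
rows 19 NOT thereby derived; N06 NOT discharged; nothing continuum ∕ OS ∕ mass gap ∕ Clay.  Cell `pub-ymgap` (D-0062), seat `pub-ymgap-dag-n06-c` (gen 23).  Net new unproved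
facts: 0.  NEW file; 0 `def`, no `sorry`, no `axiom`, no `instance`, no `notation`.  `--supports stmt-QuantumFields-27364`.

RELATED IN THE TREE, NOT DUPLICATED (searched 2026-08-30: `rg` for the basename and every decl name over `lean/Literature` + `lean/Summits` — 0 hits): `B9BlockKeyTransferXSK` (the
site instance and the rows-18 face; its §1 is NOT restated — §1 here is the carrier-generic statement it instantiates), node00-def-Y `Node00.OpsYBlockPinOfRecord` (the site laws
at the record; the bond laws are asked of NODE 00 on the bus, 2026-08-30T09:49Z).
-/

noncomputable section

namespace Literature.MathematicalPhysics.QuantumFieldTheory.Balaban1983to89.B9BlockKeyTransferXBK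

open Node00 (FBondY IBondY CfgY BondOpY cdB cdsB lapB)
open B6GlobalChartV1 (blkV1)
open B6Ineq2142KLevelV1 (β)
open B6KLevelCensusIndexV1 (KIdx)
open B6RandomWalk (HasMajorant BlockSupp)
open B6RandomWalkHom (HasMajorantHom)
open B9Thm34Ext (toB6)
open B9GeoNormsKLevelV1 (geo9K)
open B9PinMembersKLevelV1 (MemberY geo9Y)
open B9SectBAllBlocksGeometryY (geoBK geoBY dist_beta geoBK_dist_comm geoBK_dist_triangle)
open B9RWSumsReadsNbr (nbr mem_nbr)
open B9Eq352DivFormLetters (conj)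
open B9Thm39ReadingCoords (cR39 cR39_nonneg)
open B9CoReadingCoords (XBK blkBK GcoK DcoK DscoK LcoK)
open B9Local342GOfBlocksXBK (hasMajorant_GcoK_of_blocks hasMajorantHom_DcoK_GcoK_of_blocks hasMajorantHom_GcoK_DscoK_of_blocks hasMajorantHom_LcoK_GcoK_of_blocks)
open B9Thm310Whole (Ops310 Local342G)

variable {d ℓ : ℕ} {hd : 1 ≤ d + 1} {hL : Odd (ℓ + 1) ∧ 1 < ℓ + 1} {b₀ b₁ : ℝ}

/-! ## §1 The transfer «block-keyed ⟹ index-keyed» on ANY carrier -/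

section Transfer

variable (i : KIdx d ℓ hd hL b₀ b₁) [Fintype (geoBK i).Site] [Fintype (geo9K i).Site] {X : Type} (blkB : X → (geoBK i).Site) (blkI : X → IBondY i)
variable {R₀ : ℝ} {H₀ : Prop}

/-- ★★ **THE KEY TRANSFER «BLOCK ⟹ INDEX», ANY CARRIER** ([4] (2.51) with (2.45)–(2.46), (2.54), p. 248): if `T` on a carrier `X` has the block majorant `C·ℓ(s)ⁿ·e^{−δd(s,s′)}`
over the all-blocks geometry keyed by a block key `blkB`, and an index key `blkI` is 1-FAITHFUL to it (`d(β(blkI p), blkB p) ≤ 1`) and SCALE-FAITHFUL (`ℓ(blkI p) = ℓ(blkB p)`),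
and every block has at most `N₁` blocks within block-distance `1`, then `T` has the index-keyed majorant `N₁·e^{2δ}·C·ℓ(y)ⁿ·e^{−δd(y,y′)}` over the record's geometry keyed by
`blkI` — SAME rate. (A vector on the index fibre of `y′` splits into ≤ `N₁` block pieces on the blocks within distance `1` of `β y′`; (2.54) twice.)
[cite: Balaban1984PropagatorsII, (2.51) p.232, (2.45)–(2.46) p.231, (2.54) p.233, p.248; Balaban1985BackgroundPropagators, (3.41)–(3.42) p.397] -/
theorem hasMajorant_keyTransfer
    (hβ1 : ∀ p : X, (geoBK i).dist (β i.hN i.D i.hk (blkI p)) (blkB p) ≤ 1)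
    (hlen : ∀ p : X, (geo9K i).len (blkI p) = (geoBK i).len (blkB p))
    {N₁ : ℝ} (hN : ∀ t : (geoBK i).Site, ((nbr (geoBK i) 1 t).card : ℝ) ≤ N₁)
    {T : Module.End ℝ (X → ℝ)} {C δ : ℝ} (hC : 0 ≤ C) (hδ : 0 ≤ δ) (n : ℕ)
    (h : HasMajorant (g := toB6 (geoBK i) R₀ H₀) blkB T (fun s s' => C * (geoBK i).len s ^ n * Real.exp (-(δ * (geoBK i).dist s s')))) :
    HasMajorant (g := toB6 (geo9K i) R₀ H₀) blkI T
      (fun y y' => N₁ * Real.exp (2 * δ) * C * (geo9K i).len y ^ n * Real.exp (-(δ * (geo9K i).dist y y'))) := by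
  classical
  intro y' F Bd hF q
  -- the blocks carrying the index fibre of `y′`
  set S : Finset (geoBK i).Site := nbr (geoBK i) 1 (β i.hN i.D i.hk y') with hS
  -- the block pieces of `F`
  set piece : (geoBK i).Site → X → ℝ := fun s' p => if blkB p = s' then F p else 0 with hpiece
  have hFabs : ∀ p, |F p| ≤ Bd := fun p => by
    by_cases hp : blkI p = y'
    · exact hF.bound p hp
    · rw [hF.off p hp, abs_zero]; exact hF.nonneg
  have hBS : ∀ s', BlockSupp (g := toB6 (geoBK i) R₀ H₀) blkB (piece s') s' Bd := fun s' =>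
    ⟨hF.nonneg,
      fun p (hp : blkB p = s') => by
        show |(if blkB p = s' then F p else 0)| ≤ Bd
        rw [if_pos hp]; exact hFabs p,
      fun p (hp : ¬blkB p = s') => by
        show (if blkB p = s' then F p else 0) = 0
        rw [if_neg hp]⟩
  -- `F` is the sum of its pieces over `S`
  have hmemS : ∀ p, F p ≠ 0 → blkB p ∈ S := by
    intro p hp
    have hy : blkI p = y' := by
      by_contra hne; exact hp (hF.off p hne)
    rw [hS, mem_nbr, geoBK_dist_comm, ← hy]
    exact hβ1 p
  have hsum : F = ∑ s' ∈ S, piece s' := by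
    funext p
    rw [Finset.sum_apply]
    by_cases hp : F p = 0
    · rw [hp]; symm
      exact Finset.sum_eq_zero fun s' _ => by simp only [hpiece, hp, ite_self]
    · rw [Finset.sum_eq_single (blkB p) (fun s' _ hne => by simp only [hpiece, if_neg (Ne.symm hne)])
        (fun hn => absurd (hmemS p hp) hn)]
      simp only [hpiece, if_true]
  -- each piece is read by the block-keyed majorant, with (2.54) twice
  set s : (geoBK i).Site := blkB q with hs
  set y : (geo9K i).Site := blkI q with hy
  have hE : 0 ≤ C * (geoBK i).len s ^ n := mul_nonneg hC (pow_nonneg ((B9SectBAllBlocksGeometryY.geoBK_len_pos i s).le) n)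
  have hterm : ∀ s' ∈ S, |T (piece s') q| ≤ C * (geo9K i).len y ^ n * (Real.exp (2 * δ) * Real.exp (-(δ * (geo9K i).dist y y'))) * Bd := by
    intro s' hs'
    have h1 := h s' (piece s') Bd (hBS s') q
    have hd1 : (geoBK i).dist s' (β i.hN i.D i.hk y') ≤ 1 := mem_nbr.1 hs'
    have hd2 : (geoBK i).dist (β i.hN i.D i.hk y) s ≤ 1 := hβ1 q
    -- d(β y, β y′) ≤ d(β y, s) + d(s, s′) + d(s′, β y′) ≤ d(s, s′) + 2
    have htri : (geo9K i).dist y y' ≤ (geoBK i).dist s s' + 2 := by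
      rw [dist_beta]
      have t1 := geoBK_dist_triangle i (β i.hN i.D i.hk y) s (β i.hN i.D i.hk y')
      have t2 := geoBK_dist_triangle i s s' (β i.hN i.D i.hk y')
      linarith
    have hexp : Real.exp (-(δ * (geoBK i).dist s s')) ≤ Real.exp (2 * δ) * Real.exp (-(δ * (geo9K i).dist y y')) := by
      rw [← Real.exp_add, Real.exp_le_exp]
      have := mul_le_mul_of_nonneg_left htri hδ
      linarith
    calc |T (piece s') q| ≤ C * (geoBK i).len s ^ n * Real.exp (-(δ * (geoBK i).dist s s')) * Bd := h1
      _ ≤ C * (geoBK i).len s ^ n * (Real.exp (2 * δ) * Real.exp (-(δ * (geo9K i).dist y y'))) * Bd :=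
          mul_le_mul_of_nonneg_right (mul_le_mul_of_nonneg_left hexp hE) hF.nonneg
      _ = C * (geo9K i).len y ^ n * (Real.exp (2 * δ) * Real.exp (-(δ * (geo9K i).dist y y'))) * Bd := by rw [hy, hlen q]
  have hcard : (S.card : ℝ) ≤ N₁ := hN _
  have hA : 0 ≤ C * (geo9K i).len y ^ n * (Real.exp (2 * δ) * Real.exp (-(δ * (geo9K i).dist y y'))) * Bd := by
    rw [hy, hlen q]
    exact mul_nonneg (mul_nonneg hE (mul_nonneg (Real.exp_nonneg _) (Real.exp_nonneg _))) hF.nonneg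
  calc |T F q| = |∑ s' ∈ S, T (piece s') q| := by rw [hsum, map_sum, Finset.sum_apply]
    _ ≤ ∑ s' ∈ S, |T (piece s') q| := Finset.abs_sum_le_sum_abs _ _
    _ ≤ ∑ s' ∈ S, C * (geo9K i).len y ^ n * (Real.exp (2 * δ) * Real.exp (-(δ * (geo9K i).dist y y'))) * Bd := Finset.sum_le_sum hterm
    _ = (S.card : ℝ) * (C * (geo9K i).len y ^ n * (Real.exp (2 * δ) * Real.exp (-(δ * (geo9K i).dist y y'))) * Bd) := by
        rw [Finset.sum_const, nsmul_eq_mul]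
    _ ≤ N₁ * (C * (geo9K i).len y ^ n * (Real.exp (2 * δ) * Real.exp (-(δ * (geo9K i).dist y y'))) * Bd) := mul_le_mul_of_nonneg_right hcard hA
    _ = N₁ * Real.exp (2 * δ) * C * (geo9K i).len y ^ n * Real.exp (-(δ * (geo9K i).dist y y')) * Bd := by ring

/-- ★ the same transfer for the two-block form with equal carriers and keys (`HasMajorantHom blk blk = HasMajorant blk`, the shape of `Local342G.e1–e3` at a record with
`blk = blkY`). [cite: Balaban1984PropagatorsII, (2.51) p.232, (2.54) p.233, p.248; Balaban1985BackgroundPropagators, (3.42) p.397] -/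
theorem hasMajorantHom_keyTransfer
    (hβ1 : ∀ p : X, (geoBK i).dist (β i.hN i.D i.hk (blkI p)) (blkB p) ≤ 1)
    (hlen : ∀ p : X, (geo9K i).len (blkI p) = (geoBK i).len (blkB p))
    {N₁ : ℝ} (hN : ∀ t : (geoBK i).Site, ((nbr (geoBK i) 1 t).card : ℝ) ≤ N₁)
    {T : Module.End ℝ (X → ℝ)} {C δ : ℝ} (hC : 0 ≤ C) (hδ : 0 ≤ δ) (n : ℕ)
    (h : HasMajorantHom (g := toB6 (geoBK i) R₀ H₀) blkB blkB T (fun s s' => C * (geoBK i).len s ^ n * Real.exp (-(δ * (geoBK i).dist s s')))) :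
    HasMajorantHom (g := toB6 (geo9K i) R₀ H₀) blkI blkI T
      (fun y y' => N₁ * Real.exp (2 * δ) * C * (geo9K i).len y ^ n * Real.exp (-(δ * (geo9K i).dist y y'))) :=
  (B6RandomWalkHom.hasMajorantHom_iff _ _ _).2
    (hasMajorant_keyTransfer i blkB blkI hβ1 hlen hN hC hδ n ((B6RandomWalkHom.hasMajorantHom_iff _ _ _).1 h))

end Transfer

/-! ## §2 The rows-19 face: `Local342G` of an index-keyed bond record from block-keyed tables, every member -/

section Record

variable {κ : Type} [Fintype κ] {𝔸 : Type} [NormedRing 𝔸] [NormedAlgebra ℂ 𝔸] [CompleteSpace 𝔸] [FiniteDimensional ℝ 𝔸]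
variable {Mstar : ℕ} (x : MemberY d ℓ hd hL b₀ b₁ Mstar) [Fintype (geo9Y x).Site] [Fintype (geoBY x).Site] (b : Module.Basis κ ℝ 𝔸)
variable (B : B9.Backgrounds) (cfg : B.Cfg → CfgY 𝔸 x.toKIdx) (bI : FBondY x.toKIdx → IBondY x.toKIdx)
variable {R₀ : ℝ} {H₀ : Prop} {U₁ : B.Cfg}

section KShape

variable {G : B6.Geometry} {X Y : Type}

/-- a block majorant with its kernel rewritten. [folklore] -/
private theorem hasMajorant_congrK {blk : X → G.Site} {T : Module.End ℝ (X → ℝ)} {K K' : G.Site → G.Site → ℝ} (hK : K = K')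
    (h : HasMajorant (g := G) blk T K) : HasMajorant (g := G) blk T K' := by
  subst hK; exact h

/-- a two-block majorant with its kernel rewritten. [folklore] -/
private theorem hasMajorantHom_congrK {blkX : X → G.Site} {blkY : Y → G.Site} {T : (X → ℝ) →ₗ[ℝ] (Y → ℝ)} {K K' : G.Site → G.Site → ℝ} (hK : K = K')
    (h : HasMajorantHom (g := G) blkX blkY T K) : HasMajorantHom (g := G) blkX blkY T K' := by
  subst hK; exact h

/-- a block majorant transported along equalities of the block map and of the operator. [folklore] -/
private theorem hasMajorant_of_pins {blk blk' : X → G.Site} {T T' : Module.End ℝ (X → ℝ)} {K : G.Site → G.Site → ℝ} (hb : blk = blk') (hT : T = T')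
    (h : HasMajorant (g := G) blk' T' K) : HasMajorant (g := G) blk T K := by
  subst hb hT
  exact h

/-- a two-block majorant transported along equalities of the block maps and of the operator. [folklore] -/
private theorem hasMajorantHom_of_pins {blkX blkX' : X → G.Site} {blkY blkY' : Y → G.Site} {T T' : (X → ℝ) →ₗ[ℝ] (Y → ℝ)} {K : G.Site → G.Site → ℝ}
    (hX : blkX = blkX') (hY : blkY = blkY') (hT : T = T') (h : HasMajorantHom (g := G) blkX' blkY' T' K) : HasMajorantHom (g := G) blkX blkY T K := by
  subst hX hY hT
  exact h

end KShape

/-- ★★ **THE ROWS-19 FACE, ALL MEMBERS, NO SECTION** — the `Local342G` conjunct of the N06 certificate's `h36A` from BLOCK-KEYED (3.42) tables: for an index-keyed bond-sector record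
`𝔬A : Ops310 (geo9Y x) …` over the bond coordinate carrier carrying the certificate's pins — `blk = blkY = blkBK bI`, `D U ∕ Dstar U ∕ Lap U = DcoK ∕ DscoK ∕ LcoK` — and a cube-letter
pin `Gsq U j = GcoK … (O j) U`, the four block tables h0–h3 of the cube letters over the all-blocks geometry `toB6 (geoBY x) R H` keyed by `y(b₋)` (letters pinned as in p21's bond
writer: `G j = O_j(U)`, `D_ν = ∇_{U,ν}`, `D*_ν = ∇*_{U,ν}`, `L = Δ_U`; one pair `(B_c, δ)`, `0 ≤ B_c`, `0 ≤ δ`), the two laws of `bI` on bonds (1-faithful `d(β(bI b), y(b₋)) ≤ 1`,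
scale-faithful `ℓ(bI b) = ℓ(y(b₋))`) and a block count `N₁` give `Local342G 𝔬A R H (N₁·e^{2δ}·(c_R·B_c)) δ U` — rate KEPT, every factor in the constant.
[cite: Balaban1985BackgroundPropagators, Thm 3.3 p.399, Cor. 3.6 p.408 + p.409 l.1–5, (3.42) p.397, (3.87) p.409; Balaban1984PropagatorsII, (2.51) p.232, (2.54) p.233, (2.45)–(2.46) p.231, p.248] -/
theorem local342G_of_blocks_idxPins {ι A : Type} (Oc : ι → BondOpY 𝔸 x.toKIdx) (𝔬A : Ops310 (geo9Y x) B (XBK κ x.toKIdx) (XBK κ x.toKIdx) ι A)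
    (hblkA : 𝔬A.blk = blkBK x.toKIdx bI) (hblkYA : 𝔬A.blkY = blkBK x.toKIdx bI)
    (hGsqA : ∀ j, 𝔬A.Gsq U₁ j = GcoK x.toKIdx b B cfg (Oc j) U₁)
    (hDcoA : 𝔬A.D U₁ = DcoK x.toKIdx b B cfg U₁) (hDscoA : 𝔬A.Dstar U₁ = DscoK x.toKIdx b B cfg U₁) (hLcoA : 𝔬A.Lap U₁ = LcoK x.toKIdx b B cfg U₁)
    (hβ1 : ∀ f : FBondY x.toKIdx, (geoBY x).dist (β x.toKIdx.hN x.toKIdx.D x.toKIdx.hk (bI f)) (blkV1 x.toKIdx.hN x.toKIdx.D f) ≤ 1)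
    (hlen : ∀ f : FBondY x.toKIdx, (geo9Y x).len (bI f) = (geoBY x).len (blkV1 x.toKIdx.hN x.toKIdx.D f))
    {N₁ : ℝ} (hN : ∀ t : (geoBY x).Site, ((nbr (geoBY x) 1 t).card : ℝ) ≤ N₁)
    (G : ι → Module.End ℝ (FBondY x.toKIdx → 𝔸)) (hG : ∀ j Λ, G j Λ = Oc j (cfg U₁) Λ)
    (D Ds : Fin (d + 1) → Module.End ℝ (FBondY x.toKIdx → 𝔸)) (hD : ∀ ν Λ, D ν Λ = cdB x.toKIdx (cfg U₁) ν Λ) (hDs : ∀ ν Λ, Ds ν Λ = cdsB x.toKIdx (cfg U₁) ν Λ)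
    (L : Module.End ℝ (FBondY x.toKIdx → 𝔸)) (hL : ∀ Λ, L Λ = lapB x.toKIdx (cfg U₁) Λ)
    {Bc δ : ℝ} (hBc : 0 ≤ Bc) (hδ : 0 ≤ δ)
    (h0 : ∀ j, HasMajorant (g := toB6 (geoBY x) R₀ H₀) (fun p : FBondY x.toKIdx × κ => blkV1 x.toKIdx.hN x.toKIdx.D p.1) (conj b (G j))
      (fun s s' => Bc * (geoBY x).len s ^ 2 * Real.exp (-(δ * (geoBY x).dist s s'))))
    (h1 : ∀ j (ν : Fin (d + 1)), HasMajorant (g := toB6 (geoBY x) R₀ H₀) (fun p : FBondY x.toKIdx × κ => blkV1 x.toKIdx.hN x.toKIdx.D p.1)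
      (conj b (D ν) * conj b (G j)) (fun s s' => Bc * (geoBY x).len s * Real.exp (-(δ * (geoBY x).dist s s'))))
    (h2 : ∀ j (ν : Fin (d + 1)), HasMajorant (g := toB6 (geoBY x) R₀ H₀) (fun p : FBondY x.toKIdx × κ => blkV1 x.toKIdx.hN x.toKIdx.D p.1)
      (conj b (G j) * conj b (Ds ν)) (fun s s' => Bc * (geoBY x).len s * Real.exp (-(δ * (geoBY x).dist s s'))))
    (h3 : ∀ j, HasMajorant (g := toB6 (geoBY x) R₀ H₀) (fun p : FBondY x.toKIdx × κ => blkV1 x.toKIdx.hN x.toKIdx.D p.1) (conj b L * conj b (G j))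
      (fun s s' => Bc * 1 * Real.exp (-(δ * (geoBY x).dist s s')))) :
    Local342G 𝔬A R₀ H₀ (N₁ * Real.exp (2 * δ) * (cR39 b * Bc)) δ U₁ := by
  letI : Fintype (geoBK x.toKIdx).Site := (inferInstance : Fintype (geoBY x).Site)
  letI : Fintype (geo9K x.toKIdx).Site := (inferInstance : Fintype (geo9Y x).Site)
  have hC : 0 ≤ cR39 b * Bc := mul_nonneg (cR39_nonneg b) hBc
  -- the laws on the carrier
  have hβ1' : ∀ p : XBK κ x.toKIdx, (geoBK x.toKIdx).dist (β x.toKIdx.hN x.toKIdx.D x.toKIdx.hk (blkBK x.toKIdx bI p))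
      ((fun q : XBK κ x.toKIdx => blkV1 x.toKIdx.hN x.toKIdx.D q.1) p) ≤ 1 := fun p => hβ1 p.1
  have hlen' : ∀ p : XBK κ x.toKIdx, (geo9K x.toKIdx).len (blkBK x.toKIdx bI p) =
      (geoBK x.toKIdx).len ((fun q : XBK κ x.toKIdx => blkV1 x.toKIdx.hN x.toKIdx.D q.1) p) := fun p => hlen p.1
  -- block-keyed entries (`B9Local342GOfBlocksXBK` §2), kernels reshaped to `C·ℓⁿ·e^{−δd}`
  have e0 : ∀ j, HasMajorant (g := toB6 (geoBK x.toKIdx) R₀ H₀) (fun q : XBK κ x.toKIdx => blkV1 x.toKIdx.hN x.toKIdx.D q.1) (GcoK x.toKIdx b B cfg (Oc j) U₁)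
      (fun s s' => cR39 b * Bc * (geoBK x.toKIdx).len s ^ 2 * Real.exp (-(δ * (geoBK x.toKIdx).dist s s'))) := fun j =>
    hasMajorant_congrK (by
        funext s s'
        show cR39 b * (Bc * (geoBK x.toKIdx).len s ^ 2 * Real.exp (-(δ * (geoBK x.toKIdx).dist s s'))) = _
        ring)
      (hasMajorant_GcoK_of_blocks x.toKIdx b B cfg (Oc j) (R₀ := R₀) (H₀ := H₀) (G j) (hG j) (h0 j))
  have e1 : ∀ j, HasMajorantHom (g := toB6 (geoBK x.toKIdx) R₀ H₀) (fun q : XBK κ x.toKIdx => blkV1 x.toKIdx.hN x.toKIdx.D q.1)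
      (fun q : XBK κ x.toKIdx => blkV1 x.toKIdx.hN x.toKIdx.D q.1) (DcoK x.toKIdx b B cfg U₁ ∘ₗ GcoK x.toKIdx b B cfg (Oc j) U₁)
      (fun s s' => cR39 b * Bc * (geoBK x.toKIdx).len s ^ 1 * Real.exp (-(δ * (geoBK x.toKIdx).dist s s'))) := fun j =>
    hasMajorantHom_congrK (by
        funext s s'
        show cR39 b * (Bc * (geoBK x.toKIdx).len s * Real.exp (-(δ * (geoBK x.toKIdx).dist s s'))) = _
        ring)
      (hasMajorantHom_DcoK_GcoK_of_blocks x.toKIdx b B cfg (Oc j) (R₀ := R₀) (H₀ := H₀) (G j) (hG j) D hD (h1 j))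
  have e2 : ∀ j, HasMajorantHom (g := toB6 (geoBK x.toKIdx) R₀ H₀) (fun q : XBK κ x.toKIdx => blkV1 x.toKIdx.hN x.toKIdx.D q.1)
      (fun q : XBK κ x.toKIdx => blkV1 x.toKIdx.hN x.toKIdx.D q.1) (GcoK x.toKIdx b B cfg (Oc j) U₁ ∘ₗ DscoK x.toKIdx b B cfg U₁)
      (fun s s' => cR39 b * Bc * (geoBK x.toKIdx).len s ^ 1 * Real.exp (-(δ * (geoBK x.toKIdx).dist s s'))) := fun j =>
    hasMajorantHom_congrK (by
        funext s s'
        show cR39 b * (Bc * (geoBK x.toKIdx).len s * Real.exp (-(δ * (geoBK x.toKIdx).dist s s'))) = _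
        ring)
      (hasMajorantHom_GcoK_DscoK_of_blocks x.toKIdx b B cfg (Oc j) (R₀ := R₀) (H₀ := H₀) (G j) (hG j) Ds hDs (h2 j))
  have e3 : ∀ j, HasMajorantHom (g := toB6 (geoBK x.toKIdx) R₀ H₀) (fun q : XBK κ x.toKIdx => blkV1 x.toKIdx.hN x.toKIdx.D q.1)
      (fun q : XBK κ x.toKIdx => blkV1 x.toKIdx.hN x.toKIdx.D q.1) (LcoK x.toKIdx b B cfg U₁ ∘ₗ GcoK x.toKIdx b B cfg (Oc j) U₁)
      (fun s s' => cR39 b * Bc * (geoBK x.toKIdx).len s ^ 0 * Real.exp (-(δ * (geoBK x.toKIdx).dist s s'))) := fun j =>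
    hasMajorantHom_congrK (by
        funext s s'
        show cR39 b * (Bc * 1 * Real.exp (-(δ * (geoBK x.toKIdx).dist s s'))) = _
        ring)
      (hasMajorantHom_LcoK_GcoK_of_blocks x.toKIdx b B cfg (Oc j) (R₀ := R₀) (H₀ := H₀) (G j) L (hG j) hL (h3 j))
  -- transfer to the index key, then the record's pins
  refine ⟨fun j => ?_, fun j => ?_, fun j => ?_, fun j => ?_⟩
  · exact hasMajorant_of_pins hblkA (by rw [hGsqA])
      (hasMajorant_keyTransfer x.toKIdx _ (blkBK x.toKIdx bI) (R₀ := R₀) (H₀ := H₀) hβ1' hlen' hN hC hδ 2 (e0 j))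
  · exact hasMajorantHom_of_pins hblkA hblkYA (by rw [hDcoA, hGsqA])
      (hasMajorantHom_congrK (funext fun y => funext fun y' => by rw [pow_one]; rfl)
        (hasMajorantHom_keyTransfer x.toKIdx _ (blkBK x.toKIdx bI) (R₀ := R₀) (H₀ := H₀) hβ1' hlen' hN hC hδ 1 (e1 j)))
  · exact hasMajorantHom_of_pins hblkYA hblkA (by rw [hDscoA, hGsqA])
      (hasMajorantHom_congrK (funext fun y => funext fun y' => by rw [pow_one]; rfl)
        (hasMajorantHom_keyTransfer x.toKIdx _ (blkBK x.toKIdx bI) (R₀ := R₀) (H₀ := H₀) hβ1' hlen' hN hC hδ 1 (e2 j)))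
  · exact hasMajorantHom_of_pins hblkA hblkA (by rw [hLcoA, hGsqA])
      (hasMajorantHom_congrK (funext fun y => funext fun y' => by rw [pow_zero, mul_one]; rfl)
        (hasMajorantHom_keyTransfer x.toKIdx _ (blkBK x.toKIdx bI) (R₀ := R₀) (H₀ := H₀) hβ1' hlen' hN hC hδ 0 (e3 j)))

end Record

end Literature.MathematicalPhysics.QuantumFieldTheory.Balaban1983to89.B9BlockKeyTransferXBK
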